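import Literature.Geometry.Riemannian.WassersteinW1LowerSemicontinuous
import Literature.Geometry.Riemannian.WassersteinW1Prokhorov
import Mathlib.Analysis.SpecificLimits.Basic
import HarnessLib

/-!
# `(𝒫(X), d_{W₁})` is complete (Bamler 2023, §2.1; Villani 2003, §7.1)

R. Bamler, *Compactness theory of the space of super Ricci flows*, Invent. Math. 233 (2023), §2.1:
the `W₁`-Wasserstein distance *"defines a complete metric on `𝒫(X)` if we allow it to attain the
value `∞`"* (for a complete separable metric space `X`); used in §2.4, proof of the Theorem
(`(𝕄, d_{GW_p})` is complete): *"so `(φᵢ)_* μᵢ → μ'_∞ ∈ 𝒫(Z)` in `W_p`"*. The classical proof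
(e.g. Bolley 2008; Villani 2003, §7.1): a `W₁`-Cauchy sequence is tight — finitely many measures
are tight and `W₁ < η²` transfers mass bounds to `η`-thickenings (`d_{LP} ≤ √d_{W₁}`), and an
intersection of closed thickenings of compact sets with radii `→ 0` is compact — hence
subconverges weakly (Prokhorov), and the weak lower semicontinuity of `d_{W₁}` turns the Cauchy
property into `W₁`-convergence to the weak limit.

* `measure_le_measure_thickening_add_of_wassersteinW1_lt` — `d_{W₁}(μ, ν) < η²` implies
  `μ(B) ≤ ν(B_η) + η`;
* `exists_isCompact_forall_measure_compl_thickening_le` — one scale of the tightness argument;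
* `isTightMeasureSet_range_of_wassersteinW1_cauchySeq` — a `W₁`-Cauchy sequence is tight;
* `exists_tendsto_wassersteinW1_nhds_zero_of_cauchySeq` — **completeness**: a `W₁`-Cauchy
  sequence of probability measures `W₁`-converges to a probability measure.

Everything is proved; no definitions, no named facts.

## References

* R. H. Bamler, *Compactness theory of the space of super Ricci flows*, Invent. Math. 233 (2023),
  §2.1 (`d_{W_p}` is a complete metric on `𝒫(X)`); §2.4, proof of the Theorem. [Bamler2023]
* C. Villani, *Topics in Optimal Transportation*, GSM 58 (AMS 2003), §7.1. [Villani2003]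
-/

noncomputable section

open Set MeasureTheory Filter Topology Metric
open scoped ENNReal NNReal

namespace Literature.Geometry.Riemannian

variable {X : Type*} [MetricSpace X] [MeasurableSpace X] [BorelSpace X] [SecondCountableTopology X]

/-- **`d_{W₁}(μ, ν) < η²` transfers mass bounds to `η`-thickenings**: `μ(B) ≤ ν(B_η) + η` for
every Borel `B` (a coupling of cost `< η²` and Markov,
`measure_le_measure_thickening_add_of_isCoupling`). [folklore] -/
theorem measure_le_measure_thickening_add_of_wassersteinW1_lt {μ ν : Measure X}
    {η : ℝ≥0∞} (hη0 : η ≠ 0) (hηtop : η ≠ ∞) (h : wassersteinW1 μ ν < η ^ 2) {B : Set X}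
    (hB : MeasurableSet B) : μ B ≤ ν (thickening η.toReal B) + η := by
  obtain ⟨⟨q, hq⟩, hcost⟩ := iInf_lt_iff.1 h
  have hdiv : (∫⁻ p, edist p.1 p.2 ∂q) / η ≤ η :=
    ENNReal.div_le_of_le_mul (by rw [← pow_two]; exact hcost.le)
  exact (measure_le_measure_thickening_add_of_isCoupling hq hB hη0 hηtop).trans
    (add_le_add le_rfl hdiv)

variable [CompleteSpace X]

/-- **One scale of the tightness of a `W₁`-Cauchy sequence**: for `η > 0` there is a compact
`K` with `μ_k((K_η)ᶜ) ≤ 2η` for ALL `k` — choose `N` with `d_{W₁}(μ_k, μ_N) < η²` for `k ≥ N`, a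
compact `K` with `μ_j(Kᶜ) ≤ η` for `j ≤ N` (finitely many measures on a Polish space are
tight), and transfer: `μ_k((K_η)ᶜ) ≤ μ_N(((K_η)ᶜ)_η) + η ≤ μ_N(Kᶜ) + η`.
[cite: Villani2003, §7.1 (completeness of the Wasserstein space), proof] -/
theorem exists_isCompact_forall_measure_compl_thickening_le {μs : ℕ → Measure X}
    [∀ k, IsProbabilityMeasure (μs k)]
    (hC : ∀ η : ℝ≥0∞, 0 < η → ∃ N, ∀ k ≥ N, wassersteinW1 (μs k) (μs N) < η) {η : ℝ≥0}
    (hη : 0 < η) :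
    ∃ K : Set X, IsCompact K ∧ ∀ k, μs k (thickening (η : ℝ) K)ᶜ ≤ η + η := by
  obtain ⟨N, hN⟩ := hC ((η : ℝ≥0∞) ^ 2) (by positivity)
  -- a compact set carrying most of the mass of `μ_0, …, μ_N`
  have hj : ∀ j, ∃ K : Set X, IsCompact K ∧ μs j Kᶜ ≤ η := fun j ↦ by
    obtain ⟨K, hK, h⟩ := isTightMeasureSet_iff_exists_isCompact_measure_compl_le.1
      (isTightMeasureSet_singleton (μ := μs j)) η (by exact_mod_cast hη)
    exact ⟨K, hK, h _ rfl⟩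
  choose K hK hKle using hj
  set K' : Set X := ⋃ j ∈ Finset.range (N + 1), K j with hK'
  have hK'c : IsCompact K' := (Finset.range (N + 1)).isCompact_biUnion fun j _ ↦ hK j
  have hsub : ∀ j ≤ N, μs j K'ᶜ ≤ η := fun j hj ↦
    (measure_mono (compl_subset_compl.2 (subset_biUnion_of_mem (u := fun j ↦ K j)
      (Finset.mem_range.2 (Nat.lt_succ_of_le hj))))).trans (hKle j)
  refine ⟨K', hK'c, fun k ↦ ?_⟩
  rcases le_or_gt k N with hk | hk
  · calc μs k (thickening (η : ℝ) K')ᶜ ≤ μs k K'ᶜ :=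
          measure_mono (compl_subset_compl.2 (self_subset_thickening (by exact_mod_cast hη) _))
      _ ≤ η := hsub k hk
      _ ≤ η + η := le_self_add
  · have hB : MeasurableSet (thickening (η : ℝ) K')ᶜ := isOpen_thickening.measurableSet.compl
    have h1 := measure_le_measure_thickening_add_of_wassersteinW1_lt (μ := μs k) (ν := μs N)
      (by exact_mod_cast hη.ne') ENNReal.coe_ne_top (hN k hk.le) hB
    -- the `η`-thickening of the complement of the `η`-thickening of `K'` misses `K'`
    have h2 : thickening ((η : ℝ≥0∞).toReal) (thickening (η : ℝ) K')ᶜ ⊆ K'ᶜ := by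
      intro x hx hxK
      rw [ENNReal.coe_toReal, mem_thickening_iff] at hx
      obtain ⟨b, hb, hxb⟩ := hx
      exact hb (mem_thickening_iff.2 ⟨x, hxK, by rwa [dist_comm]⟩)
    calc μs k (thickening (η : ℝ) K')ᶜ
        ≤ μs N (thickening ((η : ℝ≥0∞).toReal) (thickening (η : ℝ) K')ᶜ) + η := h1
      _ ≤ μs N K'ᶜ + η := add_le_add (measure_mono h2) le_rfl
      _ ≤ η + η := add_le_add (hsub N le_rfl) le_rfl

/-- **A `W₁`-Cauchy sequence of probability measures on a Polish space is tight**: with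
`Σ_m 2η_m ≤ ε` and compact `K_m` as in `exists_isCompact_forall_measure_compl_thickening_le`, the
set `A := ⋂_m cthickening(η_m, K_m)` is closed and totally bounded, hence compact, and
`μ_k(Aᶜ) ≤ Σ_m μ_k((K_m)_{η_m}ᶜ) ≤ ε` for all `k`.
[cite: Villani2003, §7.1 (completeness of the Wasserstein space), proof] -/
theorem isTightMeasureSet_range_of_wassersteinW1_cauchySeq {μs : ℕ → Measure X}
    [∀ k, IsProbabilityMeasure (μs k)]
    (hC : ∀ η : ℝ≥0∞, 0 < η → ∃ N, ∀ k ≥ N, wassersteinW1 (μs k) (μs N) < η) :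
    IsTightMeasureSet (range μs) := by
  rw [isTightMeasureSet_iff_exists_isCompact_measure_compl_le]
  intro ε hε
  obtain ⟨ε', hε'pos, hsum⟩ :=
    ENNReal.exists_pos_sum_of_countable (ENNReal.half_pos hε.ne').ne' ℕ
  choose K hK hKle using fun m ↦
    exists_isCompact_forall_measure_compl_thickening_le hC (hε'pos m)
  set A : Set X := ⋂ m, cthickening (ε' m : ℝ) (K m) with hA
  have hclosed : IsClosed A := isClosed_iInter fun m ↦ isClosed_cthickening
  -- the radii tend to zero
  have hsum' : Summable ε' := by
    rw [← ENNReal.tsum_coe_ne_top_iff_summable]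
    exact (hsum.trans_le le_top).ne
  have ht0 : Tendsto (fun m ↦ (ε' m : ℝ)) atTop (𝓝 0) := by
    have h := (NNReal.summable_coe.2 hsum').tendsto_atTop_zero
    exact h
  refine ⟨A, ?_, ?_⟩
  · -- `A` is compact: closed and totally bounded in a complete space
    refine isCompact_iff_totallyBounded_isComplete.2 ⟨?_, hclosed.isComplete⟩
    refine Metric.totallyBounded_iff.2 fun δ hδ ↦ ?_
    obtain ⟨m, hm⟩ := (ht0.eventually (gt_mem_nhds (by positivity : (0 : ℝ) < δ / 4))).exists
    obtain ⟨t, htfin, hcover⟩ :=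
      Metric.totallyBounded_iff.1 (hK m).totallyBounded (δ / 4) (by positivity)
    refine ⟨t, htfin, fun x hx ↦ ?_⟩
    have hxm : x ∈ cthickening (ε' m : ℝ) (K m) := mem_iInter.1 hx m
    rcases (K m).eq_empty_or_nonempty with hKe | hKne
    · rw [hKe, cthickening_empty] at hxm
      exact hxm.elim
    obtain ⟨z, hz, hxz⟩ := (hK m).exists_infEDist_eq_edist hKne x
    have hdxz : dist x z ≤ ε' m := by
      rw [← edist_le_ofReal (NNReal.coe_nonneg _), ← hxz]
      exact mem_cthickening_iff.1 hxm
    obtain ⟨y, hy, hzy⟩ := mem_iUnion₂.1 (hcover hz)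
    refine mem_iUnion₂.2 ⟨y, hy, ?_⟩
    rw [mem_ball] at hzy ⊢
    calc dist x y ≤ dist x z + dist z y := dist_triangle _ _ _
      _ < δ / 4 + δ / 4 := add_lt_add (hdxz.trans_lt hm) hzy
      _ < δ := by linarith
  · -- mass bound
    rintro _ ⟨k, rfl⟩
    calc μs k Aᶜ = μs k (⋃ m, (cthickening (ε' m : ℝ) (K m))ᶜ) := by rw [hA, compl_iInter]
      _ ≤ ∑' m, μs k (cthickening (ε' m : ℝ) (K m))ᶜ := measure_iUnion_le _
      _ ≤ ∑' m, μs k (thickening (ε' m : ℝ) (K m))ᶜ := ENNReal.tsum_le_tsum fun m ↦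
          measure_mono (compl_subset_compl.2 (thickening_subset_cthickening _ _))
      _ ≤ ∑' m, ((ε' m : ℝ≥0∞) + ε' m) := ENNReal.tsum_le_tsum fun m ↦ hKle m k
      _ = ∑' m, (ε' m : ℝ≥0∞) + ∑' m, (ε' m : ℝ≥0∞) := ENNReal.tsum_add
      _ ≤ ε / 2 + ε / 2 := add_le_add hsum.le hsum.le
      _ = ε := ENNReal.add_halves ε

/-- **`(𝒫(X), d_{W₁})` is complete** (Bamler 2023, §2.1: *"a complete metric on `𝒫(X)` if we
allow it to attain the value `∞`"*; Villani 2003, §7.1): on a complete separable metric space,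
every `W₁`-Cauchy sequence of probability measures `W₁`-converges (hence also weakly,
`ProbabilityMeasure.tendsto_of_tendsto_wassersteinW1`) to a probability measure — a weak
subsequential limit exists by tightness (`isTightMeasureSet_range_of_wassersteinW1_cauchySeq`)
and Prokhorov, and `d_{W₁}(μ_k, μ) ≤ liminf_j d_{W₁}(μ_k, μ_{k_j}) ≤ η` for `k ≥ N(η)`
(`wassersteinW1_le_liminf`). [cite: Bamler2023, §2.1 (d_{W_p} is a complete metric on 𝒫(X))]
[cite: Villani2003, §7.1] -/
theorem exists_tendsto_wassersteinW1_nhds_zero_of_cauchySeq {μs : ℕ → Measure X}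
    [∀ k, IsProbabilityMeasure (μs k)]
    (hC : ∀ η : ℝ≥0∞, 0 < η → ∃ N, ∀ k ≥ N, ∀ l ≥ N, wassersteinW1 (μs k) (μs l) < η) :
    ∃ μ : Measure X, IsProbabilityMeasure μ ∧
      Tendsto (fun k ↦ wassersteinW1 (μs k) μ) atTop (𝓝 0) := by
  have hC' : ∀ η : ℝ≥0∞, 0 < η → ∃ N, ∀ k ≥ N, wassersteinW1 (μs k) (μs N) < η := fun η hη ↦ by
    obtain ⟨N, hN⟩ := hC η hη
    exact ⟨N, fun k hk ↦ hN k hk N le_rfl⟩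
  -- a weak subsequential limit
  set P : ℕ → ProbabilityMeasure X := fun k ↦ ⟨μs k, inferInstance⟩ with hP
  have hcomp : IsCompact (closure (range P)) := by
    refine isCompact_closure_of_isTightMeasureSet
      ((isTightMeasureSet_range_of_wassersteinW1_cauchySeq hC').subset ?_)
    rintro _ ⟨_, ⟨k, rfl⟩, rfl⟩
    exact ⟨k, rfl⟩
  obtain ⟨Plim, -, ψ, hψ, hlim⟩ :=
    hcomp.tendsto_subseq (x := P) fun k ↦ subset_closure (mem_range_self k)
  refine ⟨Plim, inferInstance, ?_⟩
  -- `W₁`-convergence of the whole sequence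
  rw [ENNReal.tendsto_atTop_zero]
  intro η hη
  obtain ⟨N, hN⟩ := hC η hη
  refine ⟨N, fun k hk ↦ ?_⟩
  have hlsc := wassersteinW1_le_liminf (tendsto_const_nhds (x := P k)) hlim
  refine hlsc.trans (liminf_le_of_frequently_le' (Eventually.frequently ?_))
  filter_upwards [eventually_ge_atTop N] with j hj
  exact (hN k hk (ψ j) (hj.trans (hψ.id_le j))).le

end Literature.Geometry.Riemannian

end
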